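import Summits.SmoothPoincare4.SmoothPoincare4.Theorems.RootDecompAEDoublesShadowLEOnePeelDefs

/-!
# Peeling theorem for KMN encoding graphs, part 4/8: the exponent table of `P(G)`; rows and used letters

§6 Substitutions and exponent sums in port words and gluing relators (`lift_gluingRelator`,
`expo_inl_gluingRelator`).  §7 (first part) The exponent table `tab` of the gluing relators, the used letters
`cols R` of a set of pieces and the rows `rows R L` of a peeling state, with their finset algebra.

THE FAMILY (eight modules `Theorems/RootDecompAEDoublesShadowLEOnePeel*.lean` + the closing module
`Theorems/RootDecompAEDoublesShadowLEOneStubPeelCertificates.lean`, one namespace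
`Summit.SmoothPoincare4.SmoothPoincare4.Theorems.RootDecompAEDoublesShadowLEOneStubPeelCertificates`, split by topic to respect the
400-line bound on proof files): `…PeelDefs` (verbatim twins of the skeleton's `Piece`, `ShadowGraph`,
`PeelCertificates`; free-group exponent sums; `H₁ = 0 ⟹` unimodular exponent matrix) · `…PeelBlocks` (unimodular
finset-indexed blocks of an integer table: splitting and rank bounds; the tree of pieces and its leaves) ·
`…PeelLocalTable` (the local table (★) of the twelve pieces) · `…PeelTable` (exponent sums of the relators of `P(G)`;
rows and used letters of a peeling state) · `…PeelLocalStep` (the geometry of a gluing at a piece; local certificate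
data from local unimodularity) · `…PeelCombine` (certificates of peeling states; the combination step; the set
algebra of one peeling step) · `…PeelRecursion` (the peeling recursion; the unimodular start) ·
`…StubPeelCertificates` (step L0 and the extraction: `theorem stub_peelCertificates : PeelCertificates`).
-/

open Function
open Literature.Topology.FourManifolds

set_option linter.dupNamespace false

noncomputable section

namespace Summit.SmoothPoincare4.SmoothPoincare4.Theorems.RootDecompAEDoublesShadowLEOneStubPeelCertificates

/-! ## §6 Exponent sums and substitutions in the relators of `P(G)` -/

section GraphAlgebra

variable {ι : Type} [DecidableEq ι]

/-- Exponent sums are transported along an injective renaming of the letters. -/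
theorem expo_map_injective {κ : Type} [DecidableEq κ] (f : ι → κ) (hf : Function.Injective f) (i : ι)
    (w : FreeGroup ι) : expo (f i) (FreeGroup.map f w) = expo i w := by
  have h : (gexp (f i)).comp (FreeGroup.map f) = gexp i := by
    refine FreeGroup.ext_hom _ _ fun i' => ?_
    simp only [MonoidHom.coe_comp, Function.comp_apply, FreeGroup.map.of, gexp, FreeGroup.lift_apply_of]
    by_cases hii : i' = i
    · simp [hii]
    · simp [hii, hf.ne hii]
  unfold expo
  exact congrArg Multiplicative.toAdd (DFunLike.congr_fun h w)

omit [DecidableEq ι] in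
/-- A letter outside the image of a renaming has exponent sum zero in every renamed word. -/
theorem expo_map_eq_zero {κ : Type} [DecidableEq κ] (f : ι → κ) (j : κ) (hj : ∀ i, f i ≠ j)
    (w : FreeGroup ι) : expo j (FreeGroup.map f w) = 0 := by
  have h : (gexp j).comp (FreeGroup.map f) = 1 := by
    refine FreeGroup.ext_hom _ _ fun i' => ?_
    simp [gexp, hj i']
  unfold expo
  have := DFunLike.congr_fun h w
  simp only [MonoidHom.coe_comp, Function.comp_apply, MonoidHom.one_apply] at this
  rw [this]
  rfl

omit [DecidableEq ι] in
/-- Substitution after renaming is substitution of the composite. -/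
theorem lift_map_eq {κ H : Type} [Group H] (F : κ → H) (f : ι → κ) (w : FreeGroup ι) :
    FreeGroup.lift F (FreeGroup.map f w) = FreeGroup.lift (F ∘ f) w := by
  have h : (FreeGroup.lift F).comp (FreeGroup.map f) = FreeGroup.lift (F ∘ f) :=
    FreeGroup.ext_hom _ _ fun i => by simp
  exact DFunLike.congr_fun h w

omit [DecidableEq ι] in
/-- A homomorphism applied after a substitution is the substitution of the composite. -/
theorem hom_lift_eq {H H' : Type} [Group H] [Group H'] (φ : H →* H') (f : ι → H) (w : FreeGroup ι) :
    φ (FreeGroup.lift f w) = FreeGroup.lift (φ ∘ f) w := by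
  have h : φ.comp (FreeGroup.lift f) = FreeGroup.lift (φ ∘ f) := FreeGroup.ext_hom _ _ fun i => by simp
  exact DFunLike.congr_fun h w

omit [DecidableEq ι] in
/-- Substituting `1` for every letter kills the word. -/
theorem lift_const_one {H : Type} [Group H] (w : FreeGroup ι) :
    FreeGroup.lift (fun _ : ι => (1 : H)) w = 1 := by
  have h : FreeGroup.lift (fun _ : ι => (1 : H)) = 1 := FreeGroup.ext_hom _ _ fun i => by simp
  rw [h]
  rfl

omit [DecidableEq ι] in
/-- Homomorphisms commute with the optional inversion `sgnw`. -/
theorem hom_sgnw {κ : Type} (f : FreeGroup ι →* FreeGroup κ) (t : Bool) (w : FreeGroup ι) :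
    f (sgnw t w) = sgnw t (f w) := by
  cases t <;> simp [sgnw]

end GraphAlgebra

namespace ShadowGraph

variable (G : ShadowGraph)

/-- The letters of piece `v`. -/
def ltr (v : Fin G.k) : Fin 2 → G.Gen := fun i => Sum.inl (v, i)

/-- The spine letters of one piece are distinct. -/
theorem ltr_injective (v : Fin G.k) : Function.Injective (G.ltr v) := by
  intro i j h
  simpa [ltr] using h

/-- `embed v` is the renaming `i ↦ x_(v, i)`. -/
theorem embed_apply (v : Fin G.k) (w : FreeGroup (Fin 2)) : G.embed v w = FreeGroup.map (G.ltr v) w := rfl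

/-- Substitution into a port word placed at piece `v` is substitution of the `v`-letters into the port word. -/
theorem lift_portWordAt {H : Type} [Group H] (F : G.Gen → H) (p : Fin G.k × ℕ) :
    FreeGroup.lift F (G.portWordAt p) = FreeGroup.lift (F ∘ G.ltr p.1) ((G.piece p.1).portWord p.2) := by
  unfold ShadowGraph.portWordAt
  rw [embed_apply, lift_map_eq]

/-- Exponent sum of a spine letter `x_(v, i)` in a port word placed at a piece: zero away from `v`. -/
theorem expo_inl_portWordAt (v : Fin G.k) (i : Fin 2) (p : Fin G.k × ℕ) :
    expo (Sum.inl (v, i)) (G.portWordAt p) = if p.1 = v then expo i ((G.piece p.1).portWord p.2) else 0 := by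
  unfold ShadowGraph.portWordAt
  rw [embed_apply]
  split_ifs with h
  · have : (Sum.inl (v, i) : G.Gen) = G.ltr p.1 i := by simp [ltr, h]
    rw [this, expo_map_injective _ (G.ltr_injective _)]
  · exact expo_map_eq_zero _ _ (fun i' => by simp [ltr, h]) _

/-- The orientation sign of the `e`-th gluing as an integer. -/
def osgn (e : Fin G.m) : ℤ := if G.sgn e then 1 else -1

/-- The orientation sign `±1` is a unit. -/
theorem isUnit_osgn (e : Fin G.m) : IsUnit (G.osgn e) := by
  unfold osgn; split_ifs <;> simp

/-- THE EXPONENT TABLE ENTRY of a spine letter in a gluing relator: source port word plus signed target port word. -/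
theorem expo_inl_gluingRelator (v : Fin G.k) (i : Fin 2) (e : Fin G.m) :
    expo (Sum.inl (v, i)) (G.gluingRelator e) =
      expo (Sum.inl (v, i)) (G.portWordAt (G.src e)) + G.osgn e * expo (Sum.inl (v, i)) (G.portWordAt (G.tgt e)) := by
  unfold ShadowGraph.gluingRelator ShadowGraph.stable osgn
  cases G.sgn e <;> simp

/-- EVALUATION of a substitution on a gluing relator. -/
theorem lift_gluingRelator (F : G.Gen → FreeGroup G.Gen) (e : Fin G.m) :
    FreeGroup.lift F (G.gluingRelator e) =
      FreeGroup.lift (F ∘ G.ltr (G.src e).1) ((G.piece (G.src e).1).portWord (G.src e).2) * F (Sum.inr e) *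
        sgnw (!G.sgn e) (FreeGroup.lift (F ∘ G.ltr (G.tgt e).1) ((G.piece (G.tgt e).1).portWord (G.tgt e).2)) *
          (F (Sum.inr e))⁻¹ := by
  unfold ShadowGraph.gluingRelator ShadowGraph.stable
  cases G.sgn e <;> simp [sgnw, lift_portWordAt]

/-- Two substitutions that agree on the letters of the two end pieces and on the stable letter of a gluing agree on
its relator. -/
theorem lift_gluingRelator_congr (F F' : G.Gen → FreeGroup G.Gen) (e : Fin G.m)
    (hs : ∀ i, F (Sum.inl ((G.src e).1, i)) = F' (Sum.inl ((G.src e).1, i)))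
    (ht : ∀ i, F (Sum.inl ((G.tgt e).1, i)) = F' (Sum.inl ((G.tgt e).1, i)))
    (he : F (Sum.inr e) = F' (Sum.inr e)) :
    FreeGroup.lift F (G.gluingRelator e) = FreeGroup.lift F' (G.gluingRelator e) := by
  rw [lift_gluingRelator, lift_gluingRelator, he]
  have h1 : F ∘ G.ltr (G.src e).1 = F' ∘ G.ltr (G.src e).1 := funext fun i => hs i
  have h2 : F ∘ G.ltr (G.tgt e).1 = F' ∘ G.ltr (G.tgt e).1 := funext fun i => ht i
  rw [h1, h2]

end ShadowGraph

/-! ## §7 Rows, columns and the exponent table of `P(G)`; the geometry of a gluing at a piece -/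

namespace ShadowGraph

variable (G : ShadowGraph)

/-- THE TABLE: exponent sum of the letter `g` in the `e`-th gluing relator. -/
def tab (e : Fin G.m) (g : G.Gen) : ℤ := expo g (G.gluingRelator e)

/-- The USED letters `x_(v, i)`, `i < rank (piece v)`, of the pieces `v ∈ R`. -/
def cols (R : Finset (Fin G.k)) : Finset G.Gen :=
  ((R ×ˢ (Finset.univ : Finset (Fin 2))).filter fun p => (p.2 : ℕ) < (G.piece p.1).rank).map
    ⟨Sum.inl, Sum.inl_injective⟩

/-- Membership in the used letters of `R`. -/
theorem mem_cols_iff (R : Finset (Fin G.k)) (g : G.Gen) :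
    g ∈ G.cols R ↔ ∃ v i, g = Sum.inl (v, i) ∧ v ∈ R ∧ (i : ℕ) < (G.piece v).rank := by
  constructor
  · intro h
    simp only [cols, Finset.mem_map, Finset.mem_filter, Finset.mem_product, Finset.mem_univ, and_true,
      Function.Embedding.coeFn_mk] at h
    obtain ⟨⟨v, i⟩, ⟨hv, hi⟩, rfl⟩ := h
    exact ⟨v, i, rfl, hv, hi⟩
  · rintro ⟨v, i, rfl, hv, hi⟩
    simp only [cols, Finset.mem_map, Finset.mem_filter, Finset.mem_product, Finset.mem_univ, and_true,
      Function.Embedding.coeFn_mk]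
    exact ⟨(v, i), ⟨hv, hi⟩, rfl⟩

/-- A spine letter `x_(v, i)` is a used letter of `R` iff `v ∈ R` and `i < rank (piece v)`. -/
theorem inl_mem_cols (R : Finset (Fin G.k)) (v : Fin G.k) (i : Fin 2) :
    (Sum.inl (v, i) : G.Gen) ∈ G.cols R ↔ v ∈ R ∧ (i : ℕ) < (G.piece v).rank := by
  rw [mem_cols_iff]
  constructor
  · rintro ⟨v', i', h, hv, hi⟩
    simp only [Sum.inl.injEq, Prod.mk.injEq] at h
    obtain ⟨rfl, rfl⟩ := h
    exact ⟨hv, hi⟩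
  · rintro ⟨hv, hi⟩
    exact ⟨v, i, rfl, hv, hi⟩

/-- Stable letters are never used spine letters. -/
theorem inr_not_mem_cols (R : Finset (Fin G.k)) (e : Fin G.m) : (Sum.inr e : G.Gen) ∉ G.cols R := by
  rw [mem_cols_iff]
  rintro ⟨v, i, h, -⟩
  cases h

/-- The used letters are monotone in `R`. -/
theorem cols_mono {R R' : Finset (Fin G.k)} (h : R ⊆ R') : G.cols R ⊆ G.cols R' := by
  intro g hg
  rw [mem_cols_iff] at hg ⊢
  obtain ⟨v, i, rfl, hv, hi⟩ := hg
  exact ⟨v, i, rfl, h hv, hi⟩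

/-- No pieces, no used letters. -/
theorem cols_empty : G.cols ∅ = ∅ := by
  ext g; simp [mem_cols_iff]

/-- The used letters of `R` split into those of `u ∈ R` and those of `R ∖ u`. -/
theorem cols_eq_union (R : Finset (Fin G.k)) (u : Fin G.k) (hu : u ∈ R) :
    G.cols R = G.cols {u} ∪ G.cols (R.erase u) := by
  ext g
  rw [Finset.mem_union, mem_cols_iff, mem_cols_iff, mem_cols_iff]
  constructor
  · rintro ⟨v, i, rfl, hv, hi⟩
    by_cases hvu : v = u
    · exact Or.inl ⟨v, i, rfl, by simp [hvu], hi⟩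
    · exact Or.inr ⟨v, i, rfl, Finset.mem_erase.mpr ⟨hvu, hv⟩, hi⟩
  · rintro (⟨v, i, rfl, hv, hi⟩ | ⟨v, i, rfl, hv, hi⟩)
    · rw [Finset.mem_singleton] at hv
      exact ⟨v, i, rfl, hv ▸ hu, hi⟩
    · exact ⟨v, i, rfl, Finset.mem_of_mem_erase hv, hi⟩

/-- The used letters of `u` and of `R ∖ u` are disjoint. -/
theorem cols_disjoint (R : Finset (Fin G.k)) (u : Fin G.k) : Disjoint (G.cols {u}) (G.cols (R.erase u)) := by
  rw [Finset.disjoint_left]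
  intro g h1 h2
  rw [mem_cols_iff] at h1 h2
  obtain ⟨v, i, rfl, hv, -⟩ := h1
  obtain ⟨v', i', h, hv', -⟩ := h2
  simp only [Sum.inl.injEq, Prod.mk.injEq] at h
  obtain ⟨rfl, rfl⟩ := h
  rw [Finset.mem_singleton] at hv
  exact (Finset.mem_erase.mp hv').1 hv

/-- No letter of `u` is a used letter of `R ∖ u`. -/
theorem inl_not_mem_cols_erase (R : Finset (Fin G.k)) (u : Fin G.k) (i : Fin 2) :
    (Sum.inl (u, i) : G.Gen) ∉ G.cols (R.erase u) := by
  rw [inl_mem_cols]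
  simp

/-- Every piece has rank at most two. -/
theorem rank_le_two (p : Piece) : p.rank ≤ 2 := by
  cases p <;> simp [Piece.rank]

/-- The piece `u` has `rank (piece u)` used letters. -/
theorem cols_singleton_card (u : Fin G.k) : (G.cols {u}).card = (G.piece u).rank := by
  have key : G.cols {u} =
      (Finset.univ.filter fun i : Fin 2 => (i : ℕ) < (G.piece u).rank).image fun i => (Sum.inl (u, i) : G.Gen) := by
    ext g
    rw [mem_cols_iff, Finset.mem_image]
    constructor
    · rintro ⟨v, i, rfl, hv, hi⟩
      rw [Finset.mem_singleton] at hv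
      subst hv
      exact ⟨i, by simp [hi], rfl⟩
    · rintro ⟨i, hi, rfl⟩
      exact ⟨u, i, rfl, Finset.mem_singleton_self u, by simpa using hi⟩
  rw [key, Finset.card_image_of_injective _ (fun i j h => by simpa using h)]
  have h2 := rank_le_two (G.piece u)
  generalize (G.piece u).rank = r at h2 ⊢
  interval_cases r <;> decide

/-- The used letters of a rank-one piece. -/
theorem cols_singleton_of_rank_one (u : Fin G.k) (h : (G.piece u).rank = 1) :
    G.cols {u} = {(Sum.inl (u, 0) : G.Gen)} := by
  ext g
  rw [mem_cols_iff, Finset.mem_singleton]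
  constructor
  · rintro ⟨v, i, rfl, hv, hi⟩
    rw [Finset.mem_singleton] at hv
    subst hv
    rw [h] at hi
    have : i = 0 := Fin.ext (by omega)
    rw [this]
  · rintro rfl
    exact ⟨u, 0, rfl, Finset.mem_singleton_self u, by rw [h]; simp⟩

/-- The used letters of a rank-two piece. -/
theorem cols_singleton_of_rank_two (u : Fin G.k) (h : (G.piece u).rank = 2) :
    G.cols {u} = {(Sum.inl (u, 0) : G.Gen), Sum.inl (u, 1)} := by
  ext g
  rw [mem_cols_iff, Finset.mem_insert, Finset.mem_singleton]
  constructor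
  · rintro ⟨v, i, rfl, hv, hi⟩
    rw [Finset.mem_singleton] at hv
    subst hv
    rcases Fin.exists_fin_two.mp ⟨i, rfl⟩ with hi0 | hi1
    · exact Or.inl (by rw [hi0])
    · exact Or.inr (by rw [hi1])
  · rintro (rfl | rfl)
    · exact ⟨u, 0, rfl, Finset.mem_singleton_self u, by rw [h]; simp⟩
    · exact ⟨u, 1, rfl, Finset.mem_singleton_self u, by rw [h]; simp⟩

/-- The ROWS of a peeling state: gluings with both end pieces in `R ∪ L` and at least one in `R`. -/
def rows (R L : Finset (Fin G.k)) : Finset (Fin G.m) :=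
  Finset.univ.filter fun e =>
    ((G.src e).1 ∈ R ∧ ((G.tgt e).1 ∈ R ∨ (G.tgt e).1 ∈ L)) ∨ ((G.tgt e).1 ∈ R ∧ ((G.src e).1 ∈ R ∨ (G.src e).1 ∈ L))

/-- Membership in the rows of a peeling state. -/
theorem mem_rows (R L : Finset (Fin G.k)) (e : Fin G.m) :
    e ∈ G.rows R L ↔ ((G.src e).1 ∈ R ∧ ((G.tgt e).1 ∈ R ∨ (G.tgt e).1 ∈ L)) ∨
      ((G.tgt e).1 ∈ R ∧ ((G.src e).1 ∈ R ∨ (G.src e).1 ∈ L)) := by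
  simp [rows]

/-- No pieces to peel, no rows. -/
theorem rows_empty (L : Finset (Fin G.k)) : G.rows ∅ L = ∅ := by
  ext e; simp [mem_rows]

end ShadowGraph

end Summit.SmoothPoincare4.SmoothPoincare4.Theorems.RootDecompAEDoublesShadowLEOneStubPeelCertificates
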